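import Summits.ResolutionOfSingularities.ResolutionOfSingularities.Theses.HilbertSamuelElimination
import Literature.AlgebraicGeometry.Resolution.ComponentGluing
import Literature.AlgebraicGeometry.Resolution.HilbertSamuelSemicontinuityExcellentDim
import Literature.AlgebraicGeometry.Resolution.ExcellentRingsFieldProofs
import Literature.AlgebraicGeometry.Dimension.PointDimension
import Literature.AlgebraicGeometry.Resolution.AlterationsDimension
import Literature.AlgebraicGeometry.Motives.SubschemeCyclesDimProofs
import Literature.Topology.KrullDimensionDrop

/-!
# Sketch — first lemmas of the crux ideas for `ModificationsResolve` (stmt-18507), ideator k=1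

Three levers, one first lemma each (signatures must elaborate; proofs are not required here):

* Card A `acc-induction-one-step`: stages + one-step relation `Prec`; Thm 6.17 (tree
  `Scheme.no_infinite_hsFun_tower_of_isExcellent`) ⇒ `WellFounded Prec`
  (`wellFounded_iff_isEmpty_descending_chain`); the crux by `WellFounded.induction` and
  `ComponentGluing.Scheme.HasResolution.of_isBirational` — no composite tower.
* Card B `integral-tower`: `ComponentGluing.resolutionInChar_iff_integral` ⇒ tower on integral
  schemes only; integrality climbs a birational step; `dim` is then birationally invariant
  (tree `topologicalKrullDim_eq_of_isBirational`, GluedSplitDim).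
* Card C `dense-open-dimension`: the chart formula for the height of a point
  (`PointDimension`, fact-free) makes heights local ⇒ a dense open subscheme of a scheme locally
  of finite type over a field has full dimension ⇒ `dim X' ≤ dim X` along a Σ^max-modification,
  reducible case included.
-/

set_option linter.dupNamespace false

noncomputable section

open CategoryTheory AlgebraicGeometry TopologicalSpace Order
open Literature.AlgebraicGeometry.Resolution Literature.RingTheory.HilbertSamuel

namespace Summit.ResolutionOfSingularities.ResolutionOfSingularities.Cruxes.ModificationsResolve.Sketch

/-! ### Card A — stages, the one-step relation, well-foundedness from Thm. 6.17 -/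

/-- A stage of the CJS tower over the fixed field `k` at the fixed level `N`: a reduced separated
`k`-scheme of finite type of dimension `< N` (STRICT — the form consumed by
`Scheme.isClosed_hsMaxLocus_of_isExcellent_of_dim`; `E` only needs and only returns `≤ N`). -/
structure Stage (k : Type) [Field k] (N : ℕ) : Type 1 where
  /-- the scheme -/
  Y : Scheme.{0}
  /-- its structure morphism -/
  hom : Y ⟶ Spec (.of k)
  isSeparated : IsSeparated hom
  locallyOfFiniteType : LocallyOfFiniteType hom
  quasiCompact : QuasiCompact hom
  isReduced : IsReduced Y
  /-- non-empty (an empty scheme is regular and never enters the tower; WITHOUT this field the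
  chain `∅ ≻ ∅ ≻ ⋯` — identity maps, all clauses vacuous — is an infinite descending `Prec`-chain
  and `wellFounded_prec` is FALSE) -/
  nonempty : Nonempty Y
  dim_lt : topologicalKrullDim Y < (N : WithBot ℕ∞)

/-- `s' ≺ s`: a proper birational `k`-morphism `s'.Y → s.Y` along which `H^N` does not increase
and after which no maximal value of `H^N_{s.Y}` survives (ME2) — exactly the data
(`π`, `hmono`, `hME2`) of one step of `Scheme.no_infinite_hsFun_tower_of_isExcellent`. -/
def Stage.Prec {k : Type} [Field k] {N : ℕ} (s' s : Stage k N) : Prop :=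
  ∃ π : s'.Y ⟶ s.Y, IsProper π ∧ π ≫ s.hom = s'.hom ∧ IsBirational π ∧
    (∀ x' : s'.Y, Scheme.hsFun s'.Y N x' ≤ Scheme.hsFun s.Y N (π.base x')) ∧
    ∀ ν : ℕ → ℕ, Maximal (· ∈ Scheme.hsValues s.Y N) ν → ν ∉ Scheme.hsValues s'.Y N

/-- **FIRST LEMMA of card A.** CJS Thm. 6.17 in the tree's termination form makes the one-step
relation well-founded: a descending chain `f : ℕ → Stage k N` (Mathlib
`wellFounded_iff_isEmpty_descending_chain`) IS an infinite tower of non-empty Noetherian excellent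
schemes (`Scheme.isExcellent_of_locallyOfFiniteType Stacks07QW_field_holds`) with `ψ ≤ N`
(`Scheme.hsPsi_lt_of_dim_lt`), `hmono` and (ME2): `Scheme.no_infinite_hsFun_tower_of_isExcellent`. -/
theorem Stage.wellFounded_prec (k : Type) [Field k] (N : ℕ) :
    WellFounded (fun s' s : Stage k N => s'.Prec s) := by
  rw [wellFounded_iff_isEmpty_descending_chain]
  refine ⟨fun ⟨f, hf⟩ => ?_⟩
  have hf' : ∀ n, ∃ π : (f (n + 1)).Y ⟶ (f n).Y, IsProper π ∧ π ≫ (f n).hom = (f (n + 1)).hom ∧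
      IsBirational π ∧
      (∀ x' : (f (n + 1)).Y, Scheme.hsFun (f (n + 1)).Y N x' ≤ Scheme.hsFun (f n).Y N (π.base x')) ∧
      ∀ ν : ℕ → ℕ, Maximal (· ∈ Scheme.hsValues (f n).Y N) ν → ν ∉ Scheme.hsValues (f (n + 1)).Y N :=
    hf
  choose π _hπ _hcomm _hbir hmono hME2 using hf'
  haveI hlN : ∀ n, IsLocallyNoetherian (f n).Y := fun n => by
    haveI := (f n).locallyOfFiniteType
    exact LocallyOfFiniteType.isLocallyNoetherian (f n).hom
  haveI : ∀ n, IsNoetherian (f n).Y := fun n => by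
    haveI := (f n).quasiCompact
    haveI : CompactSpace (f n).Y := QuasiCompact.compactSpace_of_compactSpace (f n).hom
    exact {}
  refine Scheme.no_infinite_hsFun_tower_of_isExcellent (fun n => (f n).Y) (fun n => ?_) N
    (fun n x => ?_) π hmono (fun n => (f n).nonempty) hME2
  · haveI := (f n).locallyOfFiniteType
    exact Scheme.isExcellent_of_locallyOfFiniteType Stacks07QW_field_holds (f n).hom
  · exact (Scheme.hsPsi_lt_of_dim_lt (f n).dim_lt x).le

/-- The step: `E` once, at level `N`, on a non-regular stage (closed nowhere-dense `Y_max` from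
support `MaxLocusNowhereDense` since `dim Y < N`; `dim Y' ≤ dim Y` by card B or C). -/
theorem Stage.exists_prec (hE : Theses.HilbertSamuelElimination.SigmaMaxModifications)
    {p : ℕ} (hp : p.Prime) {k : Type} [Field k] [CharP k p] {N : ℕ} (s : Stage k N)
    (hs : ¬ Scheme.IsRegular s.Y) : ∃ s' : Stage k N, s'.Prec s := by
  sorry

/-- How the crux follows (shape only; the real composition is the crux-plan's job). -/
theorem hasResolution_of_wellFounded {k : Type} [Field k] {N : ℕ}
    (hwf : WellFounded (fun s' s : Stage k N => s'.Prec s))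
    (hstep : ∀ s : Stage k N, ¬ Scheme.IsRegular s.Y → ∃ s' : Stage k N, s'.Prec s)
    (s : Stage k N) : Scheme.HasResolution s.Y := by
  refine hwf.induction (C := fun s : Stage k N => Scheme.HasResolution s.Y) s (fun s ih => ?_)
  by_cases hreg : Scheme.IsRegular s.Y
  · exact hreg.hasResolution
  · obtain ⟨s', hs'⟩ := hstep s hreg
    obtain ⟨π, hπ, -, hbir, -, -⟩ := id hs'
    haveI := hπ
    exact ComponentGluing.Scheme.HasResolution.of_isBirational π hbir (ih s' hs')

/-! ### Card B — the integral tower -/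

/-- Card B's transfer target `C⁺`: the crux for INTEGRAL schemes (CJS Cor. 6.18 is stated for
connected `X`; Cossart–Piltant 2019 Prop. 4.6 Step 1 reduces to irreducible ones). -/
def IntegralModificationsResolve : Prop :=
  Theses.HilbertSamuelElimination.SigmaMaxModifications →
    ∀ p : ℕ, p.Prime → ∀ (k : Type) [Field k] [CharP k p] (X : Scheme.{0})
      (f : X ⟶ Spec (.of k)), IsSeparated f → LocallyOfFiniteType f → QuasiCompact f →
        IsIntegral X → Scheme.HasResolution X

/-- `C⁺ → C` is the tree's proved component gluing (narrow-import module `ComponentGluing`). -/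
theorem modificationsResolve_of_integral (h : IntegralModificationsResolve) :
    Theses.HilbertSamuelElimination.ModificationsResolve := fun hE p hp =>
  (ComponentGluing.resolutionInChar_iff_integral p).mpr (h hE p hp)

/-- **FIRST LEMMA of card B.** Integrality climbs a birational step with reduced source
(`E` returns `X'` reduced; `π⁻¹(U) ≅ U` is a dense irreducible open of `X'`). -/
theorem isIntegral_of_isBirational_of_isReduced {X' X : Scheme.{0}} {π : X' ⟶ X}
    (hπ : IsBirational π) [IsIntegral X] [IsReduced X'] : IsIntegral X' := by
  haveI : IrreducibleSpace X' := ComponentGluing.IsBirational.irreducibleSpace hπ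
  exact isIntegral_of_irreducibleSpace_of_isReduced X'

/-- Then the dimension is a tower invariant (tree: `GluedSplitDim.topologicalKrullDim_eq_of_isBirational`,
six lines over `AlterationsDimension.topologicalKrullDim_opens_eq` / `_eq_of_isOpenImmersion`). -/
theorem topologicalKrullDim_eq_of_isBirational_integral {k : Type} [Field k] {X' X : Scheme.{0}}
    [IsIntegral X'] [IsIntegral X] (f : X ⟶ Spec (.of k)) [LocallyOfFiniteType f]
    (π : X' ⟶ X) [LocallyOfFiniteType π] (hπ : IsBirational π) :
    topologicalKrullDim X' = topologicalKrullDim X := by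
  -- verbatim the tree's `GluedSplitDim.topologicalKrullDim_eq_of_isBirational`
  obtain ⟨U, hUd, hUd', hUiso⟩ := hπ
  haveI := hUiso
  have hne : ((π ⁻¹ᵁ U : X'.Opens) : Set X').Nonempty := hUd'.nonempty
  haveI : Nonempty (π ⁻¹ᵁ U : X'.Opens) := hne.to_subtype
  haveI : IsOpenImmersion ((π ∣_ U) ≫ U.ι) := inferInstance
  calc topologicalKrullDim X' = topologicalKrullDim (π ⁻¹ᵁ U : X'.Opens) :=
        (topologicalKrullDim_opens_eq (π ≫ f) (π ⁻¹ᵁ U) hne).symm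
    _ = topologicalKrullDim X := topologicalKrullDim_eq_of_isOpenImmersion f ((π ∣_ U) ≫ U.ι)

/-! ### Card C — dense opens have full dimension (reducible case, fact-free) -/

/-- **FIRST LEMMA of card C.** The height of a point (Krull dimension of its closure) is LOCAL on
schemes locally of finite type over a field: it does not change along an open immersion (the
dimension formula `height u = height (j u) + height (fibre)`, the fibre of an injective map being
one point; equivalently the chart formula
`Literature.AlgebraicGeometry.Dimension.Scheme.height_eq_ringKrullDim_quotient_primeIdealOf`
in a common affine chart; both say `height = trdeg_K κ`). False without the finite-type hypothesis
(a DVR: the generic point has height `1` in `Spec R`, `0` in the generic fibre). -/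
theorem height_apply_eq_height_of_isOpenImmersion {K : Type} [Field K] {U X : Scheme.{0}}
    (f : X ⟶ Spec (.of K)) [LocallyOfFiniteType f] (j : U ⟶ X) [IsOpenImmersion j] (u : U) :
    Order.height (j.base u) = Order.height u := by
  rw [Literature.AlgebraicGeometry.Motives.Scheme.height_eq_height_add_height_asFiber j f u]
  have hsub : Subsingleton ↥(j.fiber (j.base u)) := by
    refine ⟨fun a b => (j.fiberHomeo (j.base u)).injective (Subtype.ext
      (j.isOpenEmbedding.injective ?_))⟩
    have ha := (j.fiberHomeo (j.base u) a).2
    have hb := (j.fiberHomeo (j.base u) b).2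
    rw [Set.mem_preimage, Set.mem_singleton_iff] at ha hb
    exact ha.trans hb.symm
  have h0 : Order.height (j.asFiber u) = 0 := by
    rw [Order.height_eq_zero]
    exact fun z _ => (Subsingleton.elim _ z).le
  rw [h0, add_zero]

/-- Consequence: a dense open subscheme of a Noetherian scheme locally of finite type over a field
has the same topological Krull dimension (every point specialises from the generic point of its
irreducible component, generic points of components lie in every dense open, `krullDim = ⨆ height`,
heights are local). -/
theorem topologicalKrullDim_eq_of_isOpenImmersion_of_denseRange {K : Type} [Field K]
    {U X : Scheme.{0}} [IsNoetherian X] (f : X ⟶ Spec (.of K)) [LocallyOfFiniteType f]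
    (j : U ⟶ X) [IsOpenImmersion j] (hd : DenseRange j.base) :
    topologicalKrullDim U = topologicalKrullDim X := by
  refine le_antisymm j.isOpenEmbedding.isInducing.topologicalKrullDim_le ?_
  rw [show topologicalKrullDim X = krullDim X from
      krullDim_eq_of_orderIso (irreducibleSetEquivPoints (α := X)),
    show topologicalKrullDim U = krullDim U from
      krullDim_eq_of_orderIso (irreducibleSetEquivPoints (α := U)),
    krullDim_eq_iSup_height, krullDim_eq_iSup_height]
  refine iSup_le fun x => ?_
  -- the generic point `η` of the irreducible component of `x` lies in the dense open `range j`
  have hirr : IsIrreducible (irreducibleComponent x) := isIrreducible_irreducibleComponent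
  have hη : IsGenericPoint hirr.genericPoint (irreducibleComponent x) :=
    hirr.isGenericPoint_genericPoint isClosed_irreducibleComponent
  obtain ⟨W, hWo, hWne, hWsub⟩ := NoetherianSpace.exists_isOpen_nonempty_subset_irreducibleComponent
    (irreducibleComponent x) (irreducibleComponent_mem_irreducibleComponents x)
  obtain ⟨u₀, hu₀W⟩ := hd.exists_mem_open hWo hWne
  have hηj : hirr.genericPoint ∈ Set.range j.base :=
    (hη.specializes (hWsub hu₀W)).mem_open j.isOpenEmbedding.isOpen_range ⟨u₀, rfl⟩
  obtain ⟨u, hu⟩ := hηj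
  have hxη : x ≤ hirr.genericPoint :=
    Scheme.le_iff_specializes.mpr (hη.specializes mem_irreducibleComponent)
  calc ((height x : ℕ∞) : WithBot ℕ∞) ≤ height hirr.genericPoint := by
        exact_mod_cast height_mono hxη
    _ = height u := by rw [← hu, height_apply_eq_height_of_isOpenImmersion f j u]
    _ ≤ ⨆ v : U, ((height v : ℕ∞) : WithBot ℕ∞) := le_iSup (fun v : U => ((height v : ℕ∞) : WithBot ℕ∞)) u

/-- The form the tower consumes: along a morphism that is an isomorphism over an open `U ⊆ X`
with dense preimage (clauses (ME1) of `E`, `U = X ∖ X_max`), the dimension does not increase —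
no integrality, no irreducible components of `X'` handled by hand. -/
theorem topologicalKrullDim_le_of_isIso_restrict {K : Type} [Field K] {X' X : Scheme.{0}}
    [IsNoetherian X'] (f : X ⟶ Spec (.of K)) [LocallyOfFiniteType f] (π : X' ⟶ X)
    [LocallyOfFiniteType π] (U : X.Opens) [IsIso (π ∣_ U)]
    (hd : Dense ((π ⁻¹ᵁ U : X'.Opens) : Set X')) :
    topologicalKrullDim X' ≤ topologicalKrullDim X := by
  have h1 : topologicalKrullDim (π ⁻¹ᵁ U : X'.Opens) = topologicalKrullDim X' :=
    topologicalKrullDim_eq_of_isOpenImmersion_of_denseRange (π ≫ f) (π ⁻¹ᵁ U).ι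
      (by rw [DenseRange, Scheme.Opens.range_ι]; exact hd)
  have h2 : topologicalKrullDim (π ⁻¹ᵁ U : X'.Opens) = topologicalKrullDim (U : X.Opens) :=
    IsHomeomorph.topologicalKrullDim_eq _ (Scheme.homeoOfIso (asIso (π ∣_ U))).isHomeomorph
  rw [← h1, h2]
  exact U.ι.isOpenEmbedding.isInducing.topologicalKrullDim_le

end Summit.ResolutionOfSingularities.ResolutionOfSingularities.Cruxes.ModificationsResolve.Sketch

end
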